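import Literature.AnabelianGeometry.AbsoluteAnabelian.AbsTopIChainsIsoCompat
import HarnessLib

/-!
# [AbsTopI] Def 4.2 (iv): the categories `Chain^{trm}(Π)`, `Chain^{iso-trm}(Π)` — composition and
# inverses of terminal (iso)morphisms, and the natural functor from `Chain(Π)` (proof-only)

S. Mochizuki, *Topics in Absolute Anabelian Geometry I: Generalities* (2012) [AbsTopI] §4, Def 4.2
(iv), pp. 50–51 (manuscript pagination, lit key `paper:url-11ac98ba15fc`; the quotation starts on
p. 50 and runs onto p. 51): "A terminal homomorphism between two `Π`-chains … is defined to be an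
open outer homomorphism `Πₙ → Ψₘ` that is compatible [up to composition with an inner automorphism]
with the open homomorphisms `Πₙ → G`, `Ψₘ → G`.  Thus, one obtains a category `Chain^{trm}(Π)` whose
objects are the `Π`-chains [with arbitrary associated type-chain], and whose morphisms are the
terminal homomorphisms between `Π`-chains; write `Chain^{iso-trm}(Π) ⊆ Chain^{trm}(Π)` for the
subcategory determined by the terminal isomorphisms [i.e., the isomorphisms of `Chain^{trm}(Π)`].
Thus, it follows immediately from the definitions that we obtain natural functors
`Chain(Π) → Chain^{iso-trm}(Π) → Chain^{trm}(Π)`."  (Doc v2, 2026-08-27: the earlier header carried a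
synthesized fragment «Moreover, we shall refer to as a terminal isomorphism …» inside the quotation
marks — referee finding L13-n5; the passage is now quoted verbatim, the single «…» marking the omitted
bracket "[with arbitrary associated type-chains]" and the displayed arrow between the two chains.)

abc-iut-L4-t4 typed the hom-sets as the predicates `PiChain.HasTerminalHom` / `HasTerminalIso`
(`AbsTopIChains.lean`; FACT-LIST vocabulary rows F-0209 / F-0210); abc-iut-f-058 proved the identities
(`AbsTopI.PiChain.hasTerminalHom_refl`, `hasTerminalIso_refl`) and the inclusion
`Chain^{iso-trm} ⊆ Chain^{trm}` (`AbsTopI.PiChain.HasTerminalIso.hasTerminalHom`).  This file supplies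
what makes them CATEGORIES and the first natural functor:

* `PiChain.HasTerminalHom.trans` — COMPOSITION in `Chain^{trm}(Π)`: the composite of open
  homomorphisms of profinite groups is open onto an open image (the second factor is an open map,
  `isOpenMap_of_isOpen_range`), and the inner automorphisms multiply;
* `PiChain.HasTerminalIso.symm`, `PiChain.HasTerminalIso.trans` — `Chain^{iso-trm}(Π)` is a groupoid;
* `AbsTopI.PiChainIsoOver.hasTerminalIso_of_refl` — the natural functor `Chain(Π) → Chain^{iso-trm}(Π)`:
  an isomorphism of `Π`-chains (over `Iso.refl`, abc-iut-L4-t13's `PiChainIsoOver`) induces a terminal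
  isomorphism (its last-term isomorphism, inner automorphism `1`), hence a terminal homomorphism
  (`hasTerminalHom_of_refl`).

Proof-only (no `def`); the typers' files are imported, not edited.  Nothing here bears on [IUTchIII]
Cor 3.12; no side is taken.
-/

noncomputable section

open CategoryTheory Topology
open scoped Pointwise

universe u

namespace Literature.AnabelianGeometry.AbsoluteAnabelian

open Literature.AlgebraicGeometry.Frobenioids (IsSlimGroup)

namespace FundamentalExtension

namespace PiChain

variable {E : FundamentalExtension.{u}} {C : CuspidalData E} {hP : IsSlimGroup E.arith}
  {hΔ : IsSlimGroup E.geom} {hne : E.geom ≠ ⊥}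

/-! ### `Chain^{trm}(Π)`: composition of terminal homomorphisms -/

/-- **Composition in `Chain^{trm}(Π)`** ([AbsTopI] Def 4.2 (iv) p. 50 "Thus, one obtains a category
`Chain^{trm}(Π)`"): terminal homomorphisms `c → c'`, `c' → c''` compose — the composite `Πₙ → Ψₘ → Φₖ`
of open homomorphisms has open image (an open-image homomorphism out of a profinite group is an open
map) and is compatible with the projections to `G` up to the product of the two inner automorphisms.
[cite: MochizukiAbsTopI2012, Def 4.2 (iv) p.50] -/
theorem HasTerminalHom.trans {c c' c'' : E.PiChain C hP hΔ hne} (h : c.HasTerminalHom c')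
    (h' : c'.HasTerminalHom c'') : c.HasTerminalHom c'' := by
  obtain ⟨φ, g, hφo, hφ⟩ := h
  obtain ⟨ψ, g', hψo, hψ⟩ := h'
  refine ⟨ψ.comp φ, g' * g, ?_, fun x => ?_⟩
  · have hr : Set.range (ψ.comp φ) = ψ '' Set.range φ := by
      rw [ContinuousMonoidHom.coe_comp, Set.range_comp]
    rw [hr]
    exact isOpenMap_of_isOpen_range ψ hψo _ hφo
  · change c''.last.proj (ψ (φ x)) = _
    rw [hψ, hφ, map_mul, MulAut.mul_apply]

/-! ### `Chain^{iso-trm}(Π)`: inverses and composition of terminal isomorphisms -/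

/-- **Inverses in `Chain^{iso-trm}(Π)`**: a terminal isomorphism `c ≅ c'` gives a terminal isomorphism
`c' ≅ c` (inverse isomorphism, inverse inner automorphism).
[cite: MochizukiAbsTopI2012, Def 4.2 (iv) p.50] -/
theorem HasTerminalIso.symm {c c' : E.PiChain C hP hΔ hne} (h : c.HasTerminalIso c') :
    c'.HasTerminalIso c := by
  obtain ⟨e, g, he⟩ := h
  refine ⟨e.symm, g⁻¹, fun y => ?_⟩
  have h1 := he (e.symm y)
  rw [ContinuousMulEquiv.apply_symm_apply] at h1
  rw [h1, ← MulAut.mul_apply, ← map_mul, inv_mul_cancel, map_one, MulAut.one_apply]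

/-- **Composition in `Chain^{iso-trm}(Π)`**: terminal isomorphisms compose.
[cite: MochizukiAbsTopI2012, Def 4.2 (iv) p.50] -/
theorem HasTerminalIso.trans {c c' c'' : E.PiChain C hP hΔ hne} (h : c.HasTerminalIso c')
    (h' : c'.HasTerminalIso c'') : c.HasTerminalIso c'' := by
  obtain ⟨e, g, he⟩ := h
  obtain ⟨e', g', he'⟩ := h'
  refine ⟨e.trans e', g' * g, fun x => ?_⟩
  change c''.last.proj (e' (e x)) = _
  rw [he', he, map_mul, MulAut.mul_apply]

/-- Terminal isomorphy is SYMMETRIC (as a relation on `Π`-chains).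
[cite: MochizukiAbsTopI2012, Def 4.2 (iv) p.50] -/
theorem hasTerminalIso_comm {c c' : E.PiChain C hP hΔ hne} :
    c.HasTerminalIso c' ↔ c'.HasTerminalIso c :=
  ⟨HasTerminalIso.symm, HasTerminalIso.symm⟩

/-- A terminal isomorphism yields terminal homomorphisms in BOTH directions (the inclusion
`Chain^{iso-trm}(Π) ⊆ Chain^{trm}(Π)` applied to the isomorphism and to its inverse).
[cite: MochizukiAbsTopI2012, Def 4.2 (iv) p.50] -/
theorem HasTerminalIso.hasTerminalHom_symm {c c' : E.PiChain C hP hΔ hne} (h : c.HasTerminalIso c') :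
    c'.HasTerminalHom c := by
  obtain ⟨e, g, he⟩ := h.symm
  refine ⟨(e : c'.last.grp →ₜ* c.last.grp), g, ?_, he⟩
  have hr : Set.range (e : c'.last.grp →ₜ* c.last.grp) = Set.univ :=
    Set.range_eq_univ.mpr fun x => ⟨e.symm x, e.apply_symm_apply x⟩
  rw [hr]
  exact isOpen_univ

end PiChain

end FundamentalExtension

/-! ### The natural functor `Chain(Π) → Chain^{iso-trm}(Π) → Chain^{trm}(Π)` -/

namespace AbsTopI.PiChainIsoOver

open FundamentalExtension

variable {E : FundamentalExtension.{u}} {C : CuspidalData E} {hP : IsSlimGroup E.arith}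
  {hΔ : IsSlimGroup E.geom} {hne : E.geom ≠ ⊥}

/-- **The natural functor `Chain(Π) → Chain^{iso-trm}(Π)`** ([AbsTopI] Def 4.2 (iv) p. 50 "it follows
immediately from the definitions that we obtain natural functors"): an isomorphism of `Π`-chains
(termwise isomorphisms compatible with the rigidifying homomorphisms, over `Iso.refl`) induces a
terminal isomorphism — its last-term isomorphism, which is compatible with the projections to `G` on
the nose (inner automorphism `1`). [cite: MochizukiAbsTopI2012, Def 4.2 (iv) p.50] -/
theorem hasTerminalIso_of_refl {c c' : E.PiChain C hP hΔ hne} (h : PiChainIsoOver (Iso.refl E) c c') :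
    c.HasTerminalIso c' := by
  obtain ⟨I⟩ := h.nonempty_last
  refine ⟨I.iso, 1, fun x => ?_⟩
  rw [map_one, MulAut.one_apply]
  exact I.proj_comm x

/-- **The composite natural functor `Chain(Π) → Chain^{trm}(Π)`**: an isomorphism of `Π`-chains over
`Iso.refl` induces a terminal homomorphism. [cite: MochizukiAbsTopI2012, Def 4.2 (iv) p.50] -/
theorem hasTerminalHom_of_refl {c c' : E.PiChain C hP hΔ hne} (h : PiChainIsoOver (Iso.refl E) c c') :
    c.HasTerminalHom c' :=
  PiChain.HasTerminalIso.hasTerminalHom (hasTerminalIso_of_refl h)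

end AbsTopI.PiChainIsoOver

end Literature.AnabelianGeometry.AbsoluteAnabelian

end
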